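import Literature.Algebra.EuclideanLattices.MRLemma510Function
import HarnessLib

/-!
# The stopping quality of the machine-level Lemma 5.10 loop, sharpened: `‖S‖ ≤ 8γη + 1`

Topic `Algebra/EuclideanLattices` (family `pqc`). The tree's loop of Micciancio–Regev 2007, Lemma 5.10
(`MRLemma510Function.lean`) calls the `IncGDD` oracle with the rational radius `r = ⌊√A⌋/8`, `A = ‖S‖²`, and
proves for the stopping case `‖S‖ ≤ 16 γ η_{2⁻ⁿ}(Λ)` through the crude `⌊√A⌋ ≥ √A/2`. For MR07 Thm. 5.23 proper
the CONSTANT matters (under the printed modulus condition `q ≥ 4√m n^{1.5} β` the witness analysis tolerates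
only `‖S‖ ≤ (8 + o(1)) β√n η`, authors' version p. 29: "`‖S‖ ≤ 8β√n η_ε(B*)`"), so this file records the sharp
form of the same stopping case, from `⌊√A⌋ > √A − 1`:

* `natSqrt_gt_sqrt_sub_one` — `√A − 1 < ⌊√A⌋`;
* `maxNorm_le_of_not_promise_sharp` — **a failed promise means `‖S‖ ≤ 8 γ η_{2⁻ⁿ}(Λ) + 1`**
  (hence `‖S‖ ≤ (8 + 1/(γη)) γη`; with `IntegerLatticeSmoothingLower` the `1/(γη)` is `O(1/n)` for `Λ ⊆ ℤⁿ`,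
  `γ ≥ √n`).

Theorems only; no named fact.

## References

* D. Micciancio, O. Regev, *Worst-case to average-case reductions based on Gaussian measures*,
  SIAM J. Comput. 37 (2007) 267–302; authors' version, Lemma 5.10 and its proof (p. 24: "when the oracle call
  fails, `‖S‖/8 ≤ γφ(B)`"), Thm. 5.23 (proof, first step, p. 29).
-/

noncomputable section

namespace Literature.Algebra.EuclideanLattices

namespace MRLemma510

/-- `√A − 1 < ⌊√A⌋` for every natural `A`. [folklore] -/
theorem natSqrt_gt_sqrt_sub_one (A : ℕ) : Real.sqrt A - 1 < (Nat.sqrt A : ℝ) := by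
  have h : (A : ℝ) < ((Nat.sqrt A + 1 : ℕ) : ℝ) ^ 2 := by exact_mod_cast Nat.lt_succ_sqrt' A
  have hs : Real.sqrt A < (Nat.sqrt A : ℝ) + 1 := by
    rw [Real.sqrt_lt' (by positivity)]
    push_cast at h
    linarith
  linarith

/-- **A failed promise means `‖S‖ ≤ 8 γ η_{2⁻ⁿ}(Λ) + 1`** (`r = ⌊√A⌋/8 > (√A − 1)/8` and `r ≤ γη` when the
promise fails): the stopping case of Lemma 5.10 with the sharp rounding loss of the rational radius.
[cite: MicciancioRegev2007, Lemma 5.10 (proof, p. 24: "‖S‖/8 ≤ γφ(B), hence ‖S‖ ≤ 8γφ(B)")] -/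
theorem maxNorm_le_of_not_promise_sharp {c : Ctx} (hc : c.WF) {V : List (List ℤ)} (hV : GoodRows c V) {γ : ℝ}
    (h : ¬ (roundInst c V).Promise γ) :
    Real.sqrt (roundA V) ≤ 8 * (γ * smoothingParameter c.lattice ((2⁻¹ : ℝ) ^ c.n)) + 1 := by
  obtain ⟨-, hA1, -, -⟩ := goodRows_norms hc hV
  have hA0 : 0 ≤ roundA V := le_trans (by norm_num) hA1
  rw [IncGDDInst.Promise, not_lt] at h
  change ((Nat.sqrt (roundA V).toNat : ℕ) : ℝ) / ((8 : ℕ) : ℝ) ≤ γ * smoothingParameter c.lattice ((2⁻¹ : ℝ) ^ c.n) at h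
  have hAc : (((roundA V).toNat : ℕ) : ℝ) = (roundA V : ℝ) := by exact_mod_cast Int.toNat_of_nonneg hA0
  have hb := natSqrt_gt_sqrt_sub_one (roundA V).toNat
  rw [hAc] at hb
  push_cast at h
  linarith

end MRLemma510

end Literature.Algebra.EuclideanLattices

end
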